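import Literature.NumberTheory.Automorphic.ArchRankOneCasimirCayleyPunctured   -- ★ p851031 (LH10-p01 (g4)): Cayley frame; brings ★ (α2), ★ (α4-S3), ★ `isCompact_setOf_exists_conj_endoBlock_mem_of_not_mem`, atlas `endoBlock`
import Literature.Analysis.Calculus.ParametricIntegralCurryJets               -- ★ p850993 (LH10-p01 (g4)): (S6-B1′) `contDiffOn_integral_of_support_local`, `iteratedFDeriv_integral_eq_of_support_local`
import Literature.Analysis.Calculus.IteratedFDerivWords                       -- ★ p851106 (this seat): words = `iteratedFDeriv` on tuples, Schwarz for words, sections, order-zero reduction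
import HarnessLib

/-!
# THE `k`-FOLD NORMALISED ORBITAL FUNCTIONAL `F(ψ, d) = (∏ᵢ 2 sin ψᵢ) · ∫ g(d, (hᵢ Tᵢ(ψᵢ) hᵢ⁻¹)ᵢ) d(⊗ᵢ νᵢ)` IS SMOOTH OFF THE WALLS AND CLOSED UNDER TANGENTIAL DERIVATIVES
# (stage (α4-S5♭) «tangential closure», part 1, of the all-orders transport of Harish-Chandra's bounds to Bouaziz's (I₂); Varadarajan 1989 §6.4, Bouaziz 1994 §3.1, Hörmander I §1.1)

Topic `NumberTheory/Automorphic`; namespace `Literature.NumberTheory.Automorphic.UnitaryGroup`.  THEOREMS ONLY (no `def`, no instance, no notation, no axiom, no `sorry`).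
Cell `pub/hodgecm-mathlib`, crux H413 (`stmt-HodgeConjecture-24833`), line LH3 (closer stub `stub_N9`, DIRECT ROAD), letter L3′ organ O-L3′ conjunct (ii) for GENERAL `fH`
(`h2` of ★ `archBzSmoothBounded_stOrbFamH_of_slab_zero`: bounded jets of the stable orbital family on `K ∩ slab₀`), (α4) «all-orders transport».  Author LH3-p01 (g5) ((α4) spec owner by
lineage, LH3-plan (g3) 10:34:26Z).  Count-neutral.

THE SETTING (abstract in the torus curves).  `ι` finite (the wall places of a base point), `G_i = U(Φ₂)_{w_i}` with measures `ν_i` finite on compacta, torus curves `T_i : ℝ → G_i` whose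
matrices are `C^∞` in `ψ` (`hTs`) and whose conjugating sets are compact off the walls `sin ψ = 0`, uniformly on compacts (`hTp`) — §1 proves both for the Cayley curves
`T(ψ) = P · diag(u e^{iψ}, u e^{−iψ}) · P⁻¹` of ★ (α2)∕(α4-S3); a finite-dimensional space `V` of SMOOTH parameters `d` (all the other coordinates of the chart); a Banach space `E`
(in the application `↥𝒮 →ᵇ ℂ`: the outer leaves curried away by ★ (CURRY-∞)); an integrand `g : V × (ι → M₂(ℂ)) → E` jointly `C^∞` with `g(d, Y) = 0` for `Y ∉ K` (one compact `K`, all `d`);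
and the functional `F : (ι → ℝ) × V → E`, `F(ψ, d) = (∏ᵢ 2 sin ψᵢ) · ∫_{Πᵢ Gᵢ} g(d, (↑↑(hᵢ Tᵢ(ψᵢ) hᵢ⁻¹))ᵢ) d(⊗ν)` (given by its defining equation `hF`, ★ (α2) style).
* §2 **the integrand** `H(h)(ψ, d) = (∏ 2 sin ψᵢ) · g(d, (↑↑hᵢ · ↑↑Tᵢ(ψᵢ) · ↑↑hᵢ⁻¹)ᵢ)` factors through ONE jointly smooth `Ψ` and the continuous `h ↦ (↑↑hᵢ, ↑↑hᵢ⁻¹)ᵢ`: every `H(h)` is `C^∞`, the jets are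
  jointly continuous (★ `continuous_iteratedFDeriv_curry_of_contDiff`), and off the walls the `h`-support is compact locally uniformly (`hTp`).
* §3 **(D) `F` is `C^∞` on `U = {∀ i, sin ψᵢ ≠ 0} × V`** (★ (S6-B1′) `contDiffOn_integral_of_support_local`) and **(C) TANGENTIAL CLOSURE** `∂_{(0,v)} F = F[∂_v g]` on `U` (★ `iteratedFDeriv_integral_eq_of_support_local`,
  order `1`), `∂_v g (d, Y) = D[g(·, Y)](d)·v` again jointly `C^∞` with the same `Y`-support.
Part 2 (★-to-be `ArchWallOrthantFunctionalJets`): the normal form of mixed words and the HEAD «all jets from the engine's `ψ`-section bounds».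
HONEST LABEL: HC_CM is proved only modulo the 7 printed citations (2 remaining: hLiu418 = stmt-HodgeConjecture-24832, h413 = stmt-HodgeConjecture-24833) until rung 0 closes; this
file is the calculus between the `k`-fold engine (`Inv ι`, LH10-p01, in flight) and the `h2` assembly ((α4-S7)), and pays nothing by itself.

## References
* [Varadarajan1989] V. S. Varadarajan, *An Introduction to Harmonic Analysis on Semisimple Lie Groups*, Cambridge Stud. Adv. Math. 16 (1989), §6.4 Thms 22–24.
* [Bouaziz1994IntegralesOrbitales] A. Bouaziz, *Intégrales orbitales sur les algèbres de Lie réductives*, Invent. Math. 115 (1994), §3.1 (I₂) p. 579.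
* [HormanderALPDO1] L. Hörmander, *The Analysis of Linear Partial Differential Operators I*, 2nd ed. (1990), §1.1 Thms. 1.1.6–1.1.9 (pp. 7–12).
* [Rogawski1990] J. D. Rogawski, *Automorphic Representations of Unitary Groups in Three Variables*, Ann. of Math. Stud. 123 (1990), §8.2 pp. 119–122.
-/

set_option autoImplicit false

noncomputable section

open MeasureTheory Measure Filter Topology Set Function NumberField NumberField.InfinitePlace Matrix Complex
open Literature.NumberTheory.Automorphic Literature.NumberTheory.Automorphic.ArchCartan Literature.Analysis.Calculus
open scoped ContDiff MatrixGroups Matrix ENNReal NNReal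
open scoped Matrix.Norms.Operator

namespace Literature.NumberTheory.Automorphic.UnitaryGroup

/-! ## §1 The Cayley torus curves: smooth matrices, compact conjugating sets off the walls -/

section CayleyTorus

variable (L : Type) [Field L] [NumberField L] (w : {w : InfinitePlace L // IsComplex w})

omit [NumberField L] in
/-- **The matrix of the Cayley torus point `P · diag(u e^{iψ}, u e^{−iψ}) · P⁻¹` is `C^∞` in `ψ`** (entries `u e^{±iψ}` through the linear map `diag`).
[cite: Rogawski1990, §8.2 p. 122] [cite: HormanderALPDO1, §1.1 pp. 7–12] -/
theorem contDiff_coe_cayleyTorus (u : Circle) :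
    ContDiff ℝ ∞ fun ψ : ℝ => (((⟨Matrix.GeneralLinearGroup.mkOfDetNeZero !![(1 : ℂ), 1; 1, -1] det_cayleyTwo_ne_zero *
        circleDiagonal 2 ![u * Circle.exp ψ, u * Circle.exp (-ψ)] * (Matrix.GeneralLinearGroup.mkOfDetNeZero !![(1 : ℂ), 1; 1, -1] det_cayleyTwo_ne_zero)⁻¹,
        cayley_conj_circleDiagonal_mem_archLocal L w _⟩ :
          ↥(archLocal L 2 (Matrix.of fun i j : Fin 2 => if i.val + j.val + 1 = 2 then (1 : L) else 0) w)) : GL (Fin 2) ℂ) : Matrix (Fin 2) (Fin 2) ℂ) := by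
  -- the entries `k ↦ u e^{±iψ}` are smooth
  have hv : ContDiff ℝ ∞ fun ψ : ℝ => fun k : Fin 2 => ((![u * Circle.exp ψ, u * Circle.exp (-ψ)] k : Circle) : ℂ) := by
    refine contDiff_pi.2 fun k => ?_
    have he : ∀ s : ℝ, ContDiff ℝ ∞ fun ψ : ℝ => ((u * Circle.exp (s * ψ) : Circle) : ℂ) := fun s => by
      have h : (fun ψ : ℝ => ((u * Circle.exp (s * ψ) : Circle) : ℂ)) = fun ψ => (u : ℂ) * Complex.exp (((s * ψ : ℝ) : ℂ) * I) :=
        funext fun ψ => by rw [Circle.coe_mul, Circle.coe_exp]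
      rw [h]
      exact contDiff_const.mul (Complex.contDiff_exp.comp ((ofRealCLM.contDiff.comp (contDiff_const.mul contDiff_id)).mul contDiff_const))
    fin_cases k
    · simpa using he 1
    · have h2 := he (-1)
      simpa using h2
  have hdiag : ContDiff ℝ ∞ fun v : Fin 2 → ℂ => Matrix.diagonal v :=
    (((Matrix.diagonalLinearMap (Fin 2) ℂ ℂ).restrictScalars ℝ).toContinuousLinearMap).contDiff
  have h : (fun ψ : ℝ => (((⟨Matrix.GeneralLinearGroup.mkOfDetNeZero !![(1 : ℂ), 1; 1, -1] det_cayleyTwo_ne_zero *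
        circleDiagonal 2 ![u * Circle.exp ψ, u * Circle.exp (-ψ)] * (Matrix.GeneralLinearGroup.mkOfDetNeZero !![(1 : ℂ), 1; 1, -1] det_cayleyTwo_ne_zero)⁻¹,
        cayley_conj_circleDiagonal_mem_archLocal L w _⟩ :
          ↥(archLocal L 2 (Matrix.of fun i j : Fin 2 => if i.val + j.val + 1 = 2 then (1 : L) else 0) w)) : GL (Fin 2) ℂ) : Matrix (Fin 2) (Fin 2) ℂ)) =
      fun ψ => ((Matrix.GeneralLinearGroup.mkOfDetNeZero !![(1 : ℂ), 1; 1, -1] det_cayleyTwo_ne_zero : GL (Fin 2) ℂ) : Matrix (Fin 2) (Fin 2) ℂ) *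
        Matrix.diagonal (fun k : Fin 2 => ((![u * Circle.exp ψ, u * Circle.exp (-ψ)] k : Circle) : ℂ)) *
        (((Matrix.GeneralLinearGroup.mkOfDetNeZero !![(1 : ℂ), 1; 1, -1] det_cayleyTwo_ne_zero)⁻¹ : GL (Fin 2) ℂ) : Matrix (Fin 2) (Fin 2) ℂ) := by
    funext ψ
    show (((Matrix.GeneralLinearGroup.mkOfDetNeZero !![(1 : ℂ), 1; 1, -1] det_cayleyTwo_ne_zero *
        circleDiagonal 2 ![u * Circle.exp ψ, u * Circle.exp (-ψ)] * (Matrix.GeneralLinearGroup.mkOfDetNeZero !![(1 : ℂ), 1; 1, -1] det_cayleyTwo_ne_zero)⁻¹ : GL (Fin 2) ℂ)) :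
        Matrix (Fin 2) (Fin 2) ℂ) = _
    rw [Units.val_mul, Units.val_mul, coe_circleDiagonal]
  rw [h]
  exact (contDiff_const.mul (hdiag.comp hv)).mul contDiff_const

/-- **COMPACT CONJUGATING SETS OFF THE WALLS, UNIFORMLY ON COMPACTS OF `ψ`**: for a compact `Kψ ⊆ ℝ` with `sin ψ ≠ 0` on it and a compact `C ⊆ U(Φ₂)_w` there is a compact `𝒞` containing
every `y` with `y · P t_u(ψ) P⁻¹ · y⁻¹ ∈ C` for some `ψ ∈ Kψ` (Harish-Chandra; ★ `isCompact_setOf_exists_conj_endoBlock_mem_of_not_mem` for the compact set of regular coordinates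
`{(θ+ψ, 0, θ−ψ) : ψ ∈ Kψ}`, `u = e^{iθ}`, chart `S = ∅`). [cite: Varadarajan1989, §6.4 Lemma 21] [cite: Rogawski1990, §8.2 p. 122] -/
theorem exists_isCompact_forall_conj_cayleyTorus_mem_imp_mem (u : Circle) {Kψ : Set ℝ} (hKψ : IsCompact Kψ) (hreg : ∀ ψ ∈ Kψ, Real.sin ψ ≠ 0)
    {C : Set ↥(archLocal L 2 (Matrix.of fun i j : Fin 2 => if i.val + j.val + 1 = 2 then (1 : L) else 0) w)} (hC : IsCompact C) :
    ∃ 𝒞 : Set ↥(archLocal L 2 (Matrix.of fun i j : Fin 2 => if i.val + j.val + 1 = 2 then (1 : L) else 0) w), IsCompact 𝒞 ∧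
      ∀ y, ∀ ψ ∈ Kψ, y * (⟨Matrix.GeneralLinearGroup.mkOfDetNeZero !![(1 : ℂ), 1; 1, -1] det_cayleyTwo_ne_zero *
          circleDiagonal 2 ![u * Circle.exp ψ, u * Circle.exp (-ψ)] * (Matrix.GeneralLinearGroup.mkOfDetNeZero !![(1 : ℂ), 1; 1, -1] det_cayleyTwo_ne_zero)⁻¹,
          cayley_conj_circleDiagonal_mem_archLocal L w _⟩ :
            ↥(archLocal L 2 (Matrix.of fun i j : Fin 2 => if i.val + j.val + 1 = 2 then (1 : L) else 0) w)) * y⁻¹ ∈ C → y ∈ 𝒞 := by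
  -- adapted from ★ `integrable_comp_conj_cayleyTorus` (LH10-p01 (g4))
  obtain ⟨θ, hθ⟩ := Circle.exp_surjective u
  -- the compact set of regular coordinates
  have hcont : Continuous fun ψ : ℝ => (fun _ : {w : InfinitePlace L // IsComplex w} => ![θ + ψ, 0, θ - ψ]) := by
    refine continuous_pi fun _ => continuous_pi fun k => ?_
    fin_cases k
    · exact continuous_const.add continuous_id
    · exact continuous_const
    · exact continuous_const.sub continuous_id
  have hKc : IsCompact ((fun ψ : ℝ => (fun _ : {w : InfinitePlace L // IsComplex w} => ![θ + ψ, 0, θ - ψ])) '' Kψ) := hKψ.image hcont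
  have hKreg : ∀ c ∈ (fun ψ : ℝ => (fun _ : {w : InfinitePlace L // IsComplex w} => ![θ + ψ, 0, θ - ψ])) '' Kψ, Circle.exp (c w 0) ≠ Circle.exp (c w 2) := by
    rintro _ ⟨ψ, hψ, rfl⟩ h
    simp only [Matrix.cons_val_zero, Matrix.cons_val_two, Matrix.tail_cons, Matrix.head_cons] at h
    obtain ⟨m, hm⟩ := Circle.exp_eq_exp.1 h
    apply hreg ψ hψ
    rw [show ψ = (m : ℝ) * Real.pi by linarith]
    exact Real.sin_int_mul_pi m
  refine ⟨_, isCompact_setOf_exists_conj_endoBlock_mem_of_not_mem L w ∅ (Finset.notMem_empty w) hKc hKreg hC, fun y ψ hψ hy => ?_⟩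
  refine ⟨fun _ => ![θ + ψ, 0, θ - ψ], ⟨ψ, hψ, rfl⟩, ?_⟩
  -- the torus point IS `endoBlock L ∅ (θ+ψ, 0, θ−ψ) w`
  have hT : (⟨Matrix.GeneralLinearGroup.mkOfDetNeZero !![(1 : ℂ), 1; 1, -1] det_cayleyTwo_ne_zero *
      circleDiagonal 2 ![u * Circle.exp ψ, u * Circle.exp (-ψ)] * (Matrix.GeneralLinearGroup.mkOfDetNeZero !![(1 : ℂ), 1; 1, -1] det_cayleyTwo_ne_zero)⁻¹,
      cayley_conj_circleDiagonal_mem_archLocal L w _⟩ :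
        ↥(archLocal L 2 (Matrix.of fun i j : Fin 2 => if i.val + j.val + 1 = 2 then (1 : L) else 0) w)) =
      endoBlock L ∅ (fun _ => ![θ + ψ, 0, θ - ψ]) w := by
    have h1 : u * Circle.exp ψ = Circle.exp (θ + ψ) := by rw [← hθ, Circle.exp_add]
    have h2 : u * Circle.exp (-ψ) = Circle.exp (θ - ψ) := by rw [← hθ, sub_eq_add_neg, Circle.exp_add]
    rw [h1, h2]
    unfold endoBlock
    rw [if_neg (Finset.notMem_empty w)]
    simp only [Matrix.cons_val_zero, Matrix.cons_val_two, Matrix.tail_cons, Matrix.head_cons]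
  rw [← hT]
  exact hy

end CayleyTorus

/-! ## §2 The integrand of the `k`-fold functional: one jointly smooth `Ψ`, jointly continuous jets, compact `h`-support off the walls -/

section Integrand

variable (L : Type) [Field L] {ι : Type*} [Fintype ι] (wl : ι → {w : InfinitePlace L // IsComplex w})
  (T : ∀ i, ℝ → ↥(archLocal L 2 (Matrix.of fun i j : Fin 2 => if i.val + j.val + 1 = 2 then (1 : L) else 0) (wl i)))
  {V : Type*} [NormedAddCommGroup V] [NormedSpace ℝ V]
  {E : Type*} [NormedAddCommGroup E] [NormedSpace ℝ E]

omit [Fintype ι] in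
/-- The matrix of a conjugate in `Πᵢ U(Φ₂)_{wᵢ}` is the product of the matrices. [cite: Rogawski1990, §8.2 p. 122] -/
theorem coe_conj_torus_apply (h : ∀ i, ↥(archLocal L 2 (Matrix.of fun i j : Fin 2 => if i.val + j.val + 1 = 2 then (1 : L) else 0) (wl i))) (ψ : ι → ℝ) (i : ι) :
    (((h i * T i (ψ i) * (h i)⁻¹ : ↥(archLocal L 2 (Matrix.of fun i j : Fin 2 => if i.val + j.val + 1 = 2 then (1 : L) else 0) (wl i))) : GL (Fin 2) ℂ) :
        Matrix (Fin 2) (Fin 2) ℂ) =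
      (((h i : ↥(archLocal L 2 _ (wl i))) : GL (Fin 2) ℂ) : Matrix (Fin 2) (Fin 2) ℂ) * (((T i (ψ i) : ↥(archLocal L 2 _ (wl i))) : GL (Fin 2) ℂ) : Matrix (Fin 2) (Fin 2) ℂ) *
        ((((h i)⁻¹ : ↥(archLocal L 2 _ (wl i))) : GL (Fin 2) ℂ) : Matrix (Fin 2) (Fin 2) ℂ) := by
  show ((((h i : ↥(archLocal L 2 _ (wl i))) : GL (Fin 2) ℂ) * ((T i (ψ i) : ↥(archLocal L 2 _ (wl i))) : GL (Fin 2) ℂ) *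
      (((h i)⁻¹ : ↥(archLocal L 2 _ (wl i))) : GL (Fin 2) ℂ) : GL (Fin 2) ℂ) : Matrix (Fin 2) (Fin 2) ℂ) = _
  rw [Units.val_mul, Units.val_mul]

/-- **THE JOINTLY SMOOTH MODEL OF THE INTEGRAND**: `Ψ(((aᵢ, bᵢ))ᵢ, (ψ, d)) = (∏ 2 sin ψᵢ) · g(d, (aᵢ · ↑↑Tᵢ(ψᵢ) · bᵢ)ᵢ)` is `C^∞` in all variables when `g` is and the torus matrices are.
[cite: HormanderALPDO1, §1.1 Thm. 1.1.7] [cite: Rogawski1990, §8.2 p. 122] -/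
theorem contDiff_torusIntegrandModel (hTs : ∀ i, ContDiff ℝ ∞ fun ψ : ℝ => (((T i ψ : ↥(archLocal L 2 _ (wl i))) : GL (Fin 2) ℂ) : Matrix (Fin 2) (Fin 2) ℂ))
    {g : V × (ι → Matrix (Fin 2) (Fin 2) ℂ) → E} (hg : ContDiff ℝ ∞ g) :
    ContDiff ℝ ∞ fun q : (ι → Matrix (Fin 2) (Fin 2) ℂ × Matrix (Fin 2) (Fin 2) ℂ) × ((ι → ℝ) × V) =>
      (∏ i, 2 * Real.sin (q.2.1 i)) • g (q.2.2, fun i => (q.1 i).1 * (((T i (q.2.1 i) : ↥(archLocal L 2 _ (wl i))) : GL (Fin 2) ℂ) : Matrix (Fin 2) (Fin 2) ℂ) * (q.1 i).2) := by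
  have hsin : ContDiff ℝ ∞ fun q : (ι → Matrix (Fin 2) (Fin 2) ℂ × Matrix (Fin 2) (Fin 2) ℂ) × ((ι → ℝ) × V) => ∏ i, 2 * Real.sin (q.2.1 i) :=
    contDiff_prod fun i _ => contDiff_const.mul (Real.contDiff_sin.comp ((contDiff_apply ℝ ℝ i).comp (contDiff_fst.comp contDiff_snd)))
  refine hsin.smul (hg.comp ((contDiff_snd.comp contDiff_snd).prodMk (contDiff_pi.2 fun i => ?_)))
  have h1 : ContDiff ℝ ∞ fun q : (ι → Matrix (Fin 2) (Fin 2) ℂ × Matrix (Fin 2) (Fin 2) ℂ) × ((ι → ℝ) × V) => q.1 i :=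
    (contDiff_apply ℝ (Matrix (Fin 2) (Fin 2) ℂ × Matrix (Fin 2) (Fin 2) ℂ) i).comp contDiff_fst
  have ha : ContDiff ℝ ∞ fun q : (ι → Matrix (Fin 2) (Fin 2) ℂ × Matrix (Fin 2) (Fin 2) ℂ) × ((ι → ℝ) × V) => (q.1 i).1 := contDiff_fst.comp h1
  have hb : ContDiff ℝ ∞ fun q : (ι → Matrix (Fin 2) (Fin 2) ℂ × Matrix (Fin 2) (Fin 2) ℂ) × ((ι → ℝ) × V) => (q.1 i).2 := contDiff_snd.comp h1
  have hm : ContDiff ℝ ∞ fun q : (ι → Matrix (Fin 2) (Fin 2) ℂ × Matrix (Fin 2) (Fin 2) ℂ) × ((ι → ℝ) × V) =>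
      (((T i (q.2.1 i) : ↥(archLocal L 2 _ (wl i))) : GL (Fin 2) ℂ) : Matrix (Fin 2) (Fin 2) ℂ) :=
    (hTs i).comp ((contDiff_apply ℝ ℝ i).comp (contDiff_fst.comp contDiff_snd))
  exact (ha.mul hm).mul hb

/-- **Every integrand `H(h) : (ψ, d) ↦ (∏ 2 sin ψᵢ) · g(d, (↑↑(hᵢ Tᵢ(ψᵢ) hᵢ⁻¹))ᵢ)` is `C^∞`** (the model `Ψ` at the point `(↑↑hᵢ, ↑↑hᵢ⁻¹)ᵢ`).
[cite: HormanderALPDO1, §1.1 Thm. 1.1.7] -/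
theorem contDiff_torusIntegrand (hTs : ∀ i, ContDiff ℝ ∞ fun ψ : ℝ => (((T i ψ : ↥(archLocal L 2 _ (wl i))) : GL (Fin 2) ℂ) : Matrix (Fin 2) (Fin 2) ℂ))
    {g : V × (ι → Matrix (Fin 2) (Fin 2) ℂ) → E} (hg : ContDiff ℝ ∞ g) (h : ∀ i, ↥(archLocal L 2 (Matrix.of fun i j : Fin 2 => if i.val + j.val + 1 = 2 then (1 : L) else 0) (wl i))) :
    ContDiff ℝ ∞ fun x : (ι → ℝ) × V => (∏ i, 2 * Real.sin (x.1 i)) •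
      g (x.2, fun i => (((h i * T i (x.1 i) * (h i)⁻¹ : ↥(archLocal L 2 _ (wl i))) : GL (Fin 2) ℂ) : Matrix (Fin 2) (Fin 2) ℂ)) := by
  have hΨ := contDiff_torusIntegrandModel L wl T hTs hg
  have heq : (fun x : (ι → ℝ) × V => (∏ i, 2 * Real.sin (x.1 i)) •
      g (x.2, fun i => (((h i * T i (x.1 i) * (h i)⁻¹ : ↥(archLocal L 2 _ (wl i))) : GL (Fin 2) ℂ) : Matrix (Fin 2) (Fin 2) ℂ))) =
      (fun q : (ι → Matrix (Fin 2) (Fin 2) ℂ × Matrix (Fin 2) (Fin 2) ℂ) × ((ι → ℝ) × V) =>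
        (∏ i, 2 * Real.sin (q.2.1 i)) • g (q.2.2, fun i => (q.1 i).1 * (((T i (q.2.1 i) : ↥(archLocal L 2 _ (wl i))) : GL (Fin 2) ℂ) : Matrix (Fin 2) (Fin 2) ℂ) * (q.1 i).2)) ∘
      fun x => ((fun i => ((((h i : ↥(archLocal L 2 _ (wl i))) : GL (Fin 2) ℂ) : Matrix (Fin 2) (Fin 2) ℂ),
        ((((h i)⁻¹ : ↥(archLocal L 2 _ (wl i))) : GL (Fin 2) ℂ) : Matrix (Fin 2) (Fin 2) ℂ))), x) := by
    funext x
    simp only [Function.comp_apply, coe_conj_torus_apply]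
  rw [heq]
  exact hΨ.comp (contDiff_const.prodMk contDiff_id)

/-- **The jets of the integrands are JOINTLY continuous in `(h, ψ, d)`** (★ `continuous_iteratedFDeriv_curry_of_contDiff` for `Ψ` along the continuous `h ↦ (↑↑hᵢ, ↑↑hᵢ⁻¹)ᵢ`).
[cite: HormanderALPDO1, §1.1 Thm. 1.1.7] -/
theorem continuous_iteratedFDeriv_torusIntegrand (hTs : ∀ i, ContDiff ℝ ∞ fun ψ : ℝ => (((T i ψ : ↥(archLocal L 2 _ (wl i))) : GL (Fin 2) ℂ) : Matrix (Fin 2) (Fin 2) ℂ))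
    {g : V × (ι → Matrix (Fin 2) (Fin 2) ℂ) → E} (hg : ContDiff ℝ ∞ g) (n : ℕ) :
    Continuous fun q : (∀ i, ↥(archLocal L 2 (Matrix.of fun i j : Fin 2 => if i.val + j.val + 1 = 2 then (1 : L) else 0) (wl i))) × ((ι → ℝ) × V) =>
      iteratedFDeriv ℝ n (fun x : (ι → ℝ) × V => (∏ i, 2 * Real.sin (x.1 i)) •
        g (x.2, fun i => (((q.1 i * T i (x.1 i) * (q.1 i)⁻¹ : ↥(archLocal L 2 _ (wl i))) : GL (Fin 2) ℂ) : Matrix (Fin 2) (Fin 2) ℂ))) q.2 := by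
  have hΨ := contDiff_torusIntegrandModel L wl T hTs hg
  have hA : Continuous fun h : (∀ i, ↥(archLocal L 2 (Matrix.of fun i j : Fin 2 => if i.val + j.val + 1 = 2 then (1 : L) else 0) (wl i))) =>
      fun i => ((((h i : ↥(archLocal L 2 _ (wl i))) : GL (Fin 2) ℂ) : Matrix (Fin 2) (Fin 2) ℂ),
        ((((h i)⁻¹ : ↥(archLocal L 2 _ (wl i))) : GL (Fin 2) ℂ) : Matrix (Fin 2) (Fin 2) ℂ)) := by
    refine continuous_pi fun i => ?_
    have hc : Continuous fun y : ↥(archLocal L 2 (Matrix.of fun i j : Fin 2 => if i.val + j.val + 1 = 2 then (1 : L) else 0) (wl i)) =>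
        ((y : GL (Fin 2) ℂ) : Matrix (Fin 2) (Fin 2) ℂ) := Units.continuous_val.comp continuous_subtype_val
    exact (hc.comp (continuous_apply i)).prodMk (hc.comp ((continuous_apply i).inv))
  have key := Literature.Analysis.Calculus.continuous_iteratedFDeriv_curry_of_contDiff (n := (⊤ : ℕ∞)) hΨ hA (m := n) (by exact_mod_cast le_top)
  exact key.congr fun q => rfl

omit [NormedSpace ℝ V] in
/-- **COMPACT `h`-SUPPORT OFF THE WALLS, LOCALLY UNIFORMLY** (the `hloc` of ★ (S6-B1′)): near every `(ψ₀, d₀)` with `sin ψ₀ᵢ ≠ 0` there are an open `W` and ONE compact `C ⊆ Πᵢ Gᵢ` off which all the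
integrands vanish on `W` (per place ★ §1-type properness `hTp` on a compact ball of `ψᵢ`'s, the `Y`-support `K` read coordinatewise, `U(Φ₂)_w ↪ M₂(ℂ)` closed).
[cite: Varadarajan1989, §6.4 Lemma 21] [cite: Rogawski1990, §8.2 p. 122] -/
theorem exists_isCompact_torusIntegrand_eq_zero
    (hTp : ∀ i (Kψ : Set ℝ), IsCompact Kψ → (∀ ψ ∈ Kψ, Real.sin ψ ≠ 0) →
      ∀ C : Set ↥(archLocal L 2 (Matrix.of fun i j : Fin 2 => if i.val + j.val + 1 = 2 then (1 : L) else 0) (wl i)), IsCompact C →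
        ∃ 𝒞 : Set ↥(archLocal L 2 (Matrix.of fun i j : Fin 2 => if i.val + j.val + 1 = 2 then (1 : L) else 0) (wl i)), IsCompact 𝒞 ∧
          ∀ y, ∀ ψ ∈ Kψ, y * T i ψ * y⁻¹ ∈ C → y ∈ 𝒞)
    {K : Set (ι → Matrix (Fin 2) (Fin 2) ℂ)} (hK : IsCompact K) {g : V × (ι → Matrix (Fin 2) (Fin 2) ℂ) → E} (hg0 : ∀ d, ∀ Y ∉ K, g (d, Y) = 0)
    (x₀ : (ι → ℝ) × V) (hx₀ : ∀ i, Real.sin (x₀.1 i) ≠ 0) :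
    ∃ W : Set ((ι → ℝ) × V), IsOpen W ∧ x₀ ∈ W ∧ W ⊆ {x | ∀ i, Real.sin (x.1 i) ≠ 0} ∧
      ∃ C : Set (∀ i, ↥(archLocal L 2 (Matrix.of fun i j : Fin 2 => if i.val + j.val + 1 = 2 then (1 : L) else 0) (wl i))), IsCompact C ∧
        ∀ h, h ∉ C → ∀ x ∈ W, (∏ i, 2 * Real.sin (x.1 i)) •
          g (x.2, fun i => (((h i * T i (x.1 i) * (h i)⁻¹ : ↥(archLocal L 2 _ (wl i))) : GL (Fin 2) ℂ) : Matrix (Fin 2) (Fin 2) ℂ)) = 0 := by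
  -- a closed ball of `ψ`'s inside the open regular set
  have hreg_open : IsOpen {ψ : ι → ℝ | ∀ i, Real.sin (ψ i) ≠ 0} := by
    have h : {ψ : ι → ℝ | ∀ i, Real.sin (ψ i) ≠ 0} = ⋂ i, (fun ψ : ι → ℝ => Real.sin (ψ i)) ⁻¹' {0}ᶜ := by ext ψ; simp
    rw [h]
    exact isOpen_iInter_of_finite fun i => (Real.continuous_sin.comp (continuous_apply i)).isOpen_preimage _ isOpen_compl_singleton
  obtain ⟨r, hr, hball⟩ := Metric.isOpen_iff.1 hreg_open x₀.1 hx₀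
  have hclosed : Metric.closedBall x₀.1 (r / 2) ⊆ {ψ : ι → ℝ | ∀ i, Real.sin (ψ i) ≠ 0} := (Metric.closedBall_subset_ball (half_lt_self hr)).trans hball
  -- per place: the compact conjugating set for `ψᵢ` in the projected ball and the projected `Y`-support
  have hce : ∀ i, IsClosedEmbedding (fun y : ↥(archLocal L 2 (Matrix.of fun i j : Fin 2 => if i.val + j.val + 1 = 2 then (1 : L) else 0) (wl i)) =>
      ((y : GL (Fin 2) ℂ) : Matrix (Fin 2) (Fin 2) ℂ)) := fun i =>
    isClosedEmbedding_coe_unitaryGroupOfForm_of_eq_over (by rw [Literature.NumberTheory.Rogawski1990.antidiagOne_map, StdForm.over_antidiagonal_eq])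
  have h𝒞 : ∀ i, ∃ 𝒞 : Set ↥(archLocal L 2 (Matrix.of fun i j : Fin 2 => if i.val + j.val + 1 = 2 then (1 : L) else 0) (wl i)), IsCompact 𝒞 ∧
      ∀ y, ∀ ψ ∈ (fun ψ : ι → ℝ => ψ i) '' Metric.closedBall x₀.1 (r / 2),
        y * T i ψ * y⁻¹ ∈ (fun y : ↥(archLocal L 2 _ (wl i)) => ((y : GL (Fin 2) ℂ) : Matrix (Fin 2) (Fin 2) ℂ)) ⁻¹' ((fun Y : ι → Matrix (Fin 2) (Fin 2) ℂ => Y i) '' K) → y ∈ 𝒞 :=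
    fun i => hTp i _ ((isCompact_closedBall x₀.1 (r / 2)).image (continuous_apply i))
      (by rintro _ ⟨ψ, hψ, rfl⟩; exact hclosed hψ i) _ ((hce i).isCompact_preimage (hK.image (continuous_apply i)))
  choose 𝒞 h𝒞c h𝒞 using h𝒞
  refine ⟨Metric.ball x₀.1 (r / 2) ×ˢ univ, Metric.isOpen_ball.prod isOpen_univ, ⟨Metric.mem_ball_self (half_pos hr), mem_univ _⟩,
    fun x hx => hclosed (Metric.ball_subset_closedBall hx.1), Set.pi univ 𝒞, isCompact_univ_pi h𝒞c, fun h hh x hx => ?_⟩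
  -- off `Π 𝒞ᵢ` some `hᵢ ∉ 𝒞ᵢ`, so the conjugate tuple is not in `K` and `g` vanishes
  obtain ⟨i, -, hi⟩ : ∃ i, i ∈ univ ∧ h i ∉ 𝒞 i := by simpa [Set.mem_univ_pi] using hh
  have hY : (fun i => (((h i * T i (x.1 i) * (h i)⁻¹ : ↥(archLocal L 2 _ (wl i))) : GL (Fin 2) ℂ) : Matrix (Fin 2) (Fin 2) ℂ)) ∉ K := by
    intro hYK
    exact hi (h𝒞 i (h i) (x.1 i) ⟨x.1, Metric.ball_subset_closedBall hx.1, rfl⟩ ⟨_, hYK, rfl⟩)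
  rw [hg0 x.2 _ hY, smul_zero]

end Integrand

/-! ## §3a Tangential derivatives of the integrand -/

section Tangential

variable {ι : Type*} [Fintype ι] {V : Type*} [NormedAddCommGroup V] [NormedSpace ℝ V] {E : Type*} [NormedAddCommGroup E] [NormedSpace ℝ E]
  {K : Set (ι → Matrix (Fin 2) (Fin 2) ℂ)}

/-- **The tangential derivative `∂_v g (d, Y) = D[g(·, Y)](d)·v` of a jointly `C^∞`, `K`-supported integrand is again jointly `C^∞` and `K`-supported.** [cite: HormanderALPDO1, §1.1 Thm. 1.1.7] -/
theorem contDiff_tangentialDeriv {g : V × (ι → Matrix (Fin 2) (Fin 2) ℂ) → E} (hg : ContDiff ℝ ∞ g) (hg0 : ∀ d, ∀ Y ∉ K, g (d, Y) = 0) (v : V) :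
    ContDiff ℝ ∞ (fun q : V × (ι → Matrix (Fin 2) (Fin 2) ℂ) => fderiv ℝ (fun d => g (d, q.2)) q.1 v) ∧
      ∀ d, ∀ Y ∉ K, fderiv ℝ (fun d => g (d, Y)) d v = 0 := by
  constructor
  · -- `D[g(·,Y)](d)·v = Dg(d,Y)·(v,0)`
    have heq : (fun q : V × (ι → Matrix (Fin 2) (Fin 2) ℂ) => fderiv ℝ (fun d => g (d, q.2)) q.1 v) = fun q => fderiv ℝ g q (v, 0) := by
      funext q
      rw [show q = (q.1, q.2) from rfl]
      exact (fderiv_apply_inl_eq_fderiv_section ((hg.differentiable (by simp)) _) v).symm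
    rw [heq]
    exact (hg.fderiv_right (m := ∞) (by simp)).clm_apply contDiff_const
  · intro d Y hY
    have h : (fun d => g (d, Y)) = fun _ => 0 := funext fun d => hg0 d Y hY
    rw [h]
    simp


end Tangential

/-! ## §3 (D) the functional is `C^∞` off the walls; (C) tangential closure `∂_{(0,v)} F = F[∂_v g]` -/

section Functional

variable (L : Type) [Field L] {ι : Type*} [Fintype ι] (wl : ι → {w : InfinitePlace L // IsComplex w})
  [∀ i, MeasurableSpace ↥(archLocal L 2 (Matrix.of fun i j : Fin 2 => if i.val + j.val + 1 = 2 then (1 : L) else 0) (wl i))]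
  [∀ i, BorelSpace ↥(archLocal L 2 (Matrix.of fun i j : Fin 2 => if i.val + j.val + 1 = 2 then (1 : L) else 0) (wl i))]
  (ν : ∀ i, Measure ↥(archLocal L 2 (Matrix.of fun i j : Fin 2 => if i.val + j.val + 1 = 2 then (1 : L) else 0) (wl i)))
  [∀ i, IsFiniteMeasureOnCompacts (ν i)] [∀ i, SigmaFinite (ν i)]
  (T : ∀ i, ℝ → ↥(archLocal L 2 (Matrix.of fun i j : Fin 2 => if i.val + j.val + 1 = 2 then (1 : L) else 0) (wl i)))
  (hTs : ∀ i, ContDiff ℝ ∞ fun ψ : ℝ => (((T i ψ : ↥(archLocal L 2 (Matrix.of fun i j : Fin 2 => if i.val + j.val + 1 = 2 then (1 : L) else 0) (wl i))) :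
    GL (Fin 2) ℂ) : Matrix (Fin 2) (Fin 2) ℂ))
  (hTp : ∀ i (Kψ : Set ℝ), IsCompact Kψ → (∀ ψ ∈ Kψ, Real.sin ψ ≠ 0) →
    ∀ C : Set ↥(archLocal L 2 (Matrix.of fun i j : Fin 2 => if i.val + j.val + 1 = 2 then (1 : L) else 0) (wl i)), IsCompact C →
      ∃ 𝒞 : Set ↥(archLocal L 2 (Matrix.of fun i j : Fin 2 => if i.val + j.val + 1 = 2 then (1 : L) else 0) (wl i)), IsCompact 𝒞 ∧
        ∀ y, ∀ ψ ∈ Kψ, y * T i ψ * y⁻¹ ∈ C → y ∈ 𝒞)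
  {V : Type*} [NormedAddCommGroup V] [NormedSpace ℝ V] [FiniteDimensional ℝ V]
  {E : Type*} [NormedAddCommGroup E] [NormedSpace ℝ E] [CompleteSpace E]
  {K : Set (ι → Matrix (Fin 2) (Fin 2) ℂ)} (hK : IsCompact K)

include hTs hTp hK

omit [CompleteSpace E] in
/-- **(D) THE FUNCTIONAL IS `C^∞` OFF THE WALLS**: `F(ψ, d) = (∏ 2 sin ψᵢ) · ∫ g(d, (↑↑(hᵢTᵢ(ψᵢ)hᵢ⁻¹))ᵢ) d(⊗ν)` is `C^∞` on `U = {∀ i, sin ψᵢ ≠ 0} × V` (★ (S6-B1′) `contDiffOn_integral_of_support_local`, its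
three hypotheses from §2). [cite: Varadarajan1989, §6.4 Thm 23] [cite: HormanderALPDO1, §1.1 Thm. 1.1.9] -/
theorem contDiffOn_torusFunctional {g : V × (ι → Matrix (Fin 2) (Fin 2) ℂ) → E} (hg : ContDiff ℝ ∞ g) (hg0 : ∀ d, ∀ Y ∉ K, g (d, Y) = 0)
    {F : (ι → ℝ) × V → E} (hF : ∀ ψ d, F (ψ, d) = (∏ i, 2 * Real.sin (ψ i)) •
      ∫ h : (∀ i, ↥(archLocal L 2 (Matrix.of fun i j : Fin 2 => if i.val + j.val + 1 = 2 then (1 : L) else 0) (wl i))),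
        g (d, fun i => (((h i * T i (ψ i) * (h i)⁻¹ : ↥(archLocal L 2 _ (wl i))) : GL (Fin 2) ℂ) : Matrix (Fin 2) (Fin 2) ℂ)) ∂(Measure.pi ν)) :
    ContDiffOn ℝ ∞ F {x | ∀ i, Real.sin (x.1 i) ≠ 0} := by
  haveI : ∀ i, SecondCountableTopology ↥(archLocal L 2 (Matrix.of fun i j : Fin 2 => if i.val + j.val + 1 = 2 then (1 : L) else 0) (wl i)) :=
    fun i => secondCountableTopology_archLocal L 2 _ (wl i)
  have hU : IsOpen {x : (ι → ℝ) × V | ∀ i, Real.sin (x.1 i) ≠ 0} := by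
    have h : {x : (ι → ℝ) × V | ∀ i, Real.sin (x.1 i) ≠ 0} = ⋂ i, (fun x : (ι → ℝ) × V => Real.sin (x.1 i)) ⁻¹' {0}ᶜ := by ext x; simp
    rw [h]
    exact isOpen_iInter_of_finite fun i => (Real.continuous_sin.comp ((continuous_apply i).comp continuous_fst)).isOpen_preimage _ isOpen_compl_singleton
  have hFeq : F = fun x => ∫ h : (∀ i, ↥(archLocal L 2 (Matrix.of fun i j : Fin 2 => if i.val + j.val + 1 = 2 then (1 : L) else 0) (wl i))),
      (∏ i, 2 * Real.sin (x.1 i)) • g (x.2, fun i => (((h i * T i (x.1 i) * (h i)⁻¹ : ↥(archLocal L 2 _ (wl i))) : GL (Fin 2) ℂ) : Matrix (Fin 2) (Fin 2) ℂ)) ∂(Measure.pi ν) := by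
    funext x
    rw [show x = (x.1, x.2) from rfl, hF, integral_smul]
  rw [hFeq]
  refine contDiffOn_integral_of_support_local (μ := Measure.pi ν) hU (fun h => (contDiff_torusIntegrand L wl T hTs hg h).contDiffOn)
    (fun n => (continuous_iteratedFDeriv_torusIntegrand L wl T hTs hg n).continuousOn) fun x₀ hx₀ => ?_
  obtain ⟨W, hWo, hxW, hWU, C, hC, hCz⟩ := exists_isCompact_torusIntegrand_eq_zero L wl T hTp hK hg0 x₀ hx₀
  exact ⟨W, hWo, hxW, hWU, C, hC, hCz⟩

/-- **(C) TANGENTIAL CLOSURE**: on `U`, the derivative of `F` along `(0, v)` is the functional of `∂_v g`: `DF(ψ,d)·(0,v) = (∏ 2 sin ψᵢ) · ∫ ∂_v g(d, (↑↑(hᵢTᵢ(ψᵢ)hᵢ⁻¹))ᵢ) d(⊗ν)`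
(★ `iteratedFDeriv_integral_eq_of_support_local` at order `1`, evaluation at `(0, v)` commutes with the Bochner integral, the section rule).
[cite: Varadarajan1989, §6.4 Thm 23] [cite: HormanderALPDO1, §1.1 Thm. 1.1.9] -/
theorem fderiv_torusFunctional_inr_eqOn {g : V × (ι → Matrix (Fin 2) (Fin 2) ℂ) → E} (hg : ContDiff ℝ ∞ g) (hg0 : ∀ d, ∀ Y ∉ K, g (d, Y) = 0)
    {F : (ι → ℝ) × V → E} (hF : ∀ ψ d, F (ψ, d) = (∏ i, 2 * Real.sin (ψ i)) •
      ∫ h : (∀ i, ↥(archLocal L 2 (Matrix.of fun i j : Fin 2 => if i.val + j.val + 1 = 2 then (1 : L) else 0) (wl i))),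
        g (d, fun i => (((h i * T i (ψ i) * (h i)⁻¹ : ↥(archLocal L 2 _ (wl i))) : GL (Fin 2) ℂ) : Matrix (Fin 2) (Fin 2) ℂ)) ∂(Measure.pi ν))
    (v : V) {F' : (ι → ℝ) × V → E} (hF' : ∀ ψ d, F' (ψ, d) = (∏ i, 2 * Real.sin (ψ i)) •
      ∫ h : (∀ i, ↥(archLocal L 2 (Matrix.of fun i j : Fin 2 => if i.val + j.val + 1 = 2 then (1 : L) else 0) (wl i))),
        fderiv ℝ (fun d' => g (d', fun i => (((h i * T i (ψ i) * (h i)⁻¹ : ↥(archLocal L 2 _ (wl i))) : GL (Fin 2) ℂ) : Matrix (Fin 2) (Fin 2) ℂ))) d v ∂(Measure.pi ν)) :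
    EqOn (fun x => fderiv ℝ F x ((0 : ι → ℝ), v)) F' {x | ∀ i, Real.sin (x.1 i) ≠ 0} := by
  haveI : ∀ i, SecondCountableTopology ↥(archLocal L 2 (Matrix.of fun i j : Fin 2 => if i.val + j.val + 1 = 2 then (1 : L) else 0) (wl i)) :=
    fun i => secondCountableTopology_archLocal L 2 _ (wl i)
  have hU : IsOpen {x : (ι → ℝ) × V | ∀ i, Real.sin (x.1 i) ≠ 0} := by
    have h : {x : (ι → ℝ) × V | ∀ i, Real.sin (x.1 i) ≠ 0} = ⋂ i, (fun x : (ι → ℝ) × V => Real.sin (x.1 i)) ⁻¹' {0}ᶜ := by ext x; simp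
    rw [h]
    exact isOpen_iInter_of_finite fun i => (Real.continuous_sin.comp ((continuous_apply i).comp continuous_fst)).isOpen_preimage _ isOpen_compl_singleton
  -- abbreviate the integrand family `H h x`
  obtain ⟨H, hH_def⟩ : ∃ H : (∀ i, ↥(archLocal L 2 (Matrix.of fun i j : Fin 2 => if i.val + j.val + 1 = 2 then (1 : L) else 0) (wl i))) → (ι → ℝ) × V → E,
      H = fun h x => (∏ i, 2 * Real.sin (x.1 i)) •
        g (x.2, fun i => (((h i * T i (x.1 i) * (h i)⁻¹ : ↥(archLocal L 2 _ (wl i))) : GL (Fin 2) ℂ) : Matrix (Fin 2) (Fin 2) ℂ)) := ⟨_, rfl⟩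
  have hHs : ∀ h, ContDiff ℝ ∞ (H h) := fun h => by rw [hH_def]; exact contDiff_torusIntegrand L wl T hTs hg h
  have hHc : ∀ n : ℕ, ContinuousOn (fun q : (∀ i, ↥(archLocal L 2 (Matrix.of fun i j : Fin 2 => if i.val + j.val + 1 = 2 then (1 : L) else 0) (wl i))) × ((ι → ℝ) × V) =>
      iteratedFDeriv ℝ n (H q.1) q.2) (univ ×ˢ {x | ∀ i, Real.sin (x.1 i) ≠ 0}) := fun n => by
    rw [hH_def]; exact (continuous_iteratedFDeriv_torusIntegrand L wl T hTs hg n).continuousOn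
  have hHloc : ∀ x₀ ∈ {x : (ι → ℝ) × V | ∀ i, Real.sin (x.1 i) ≠ 0}, ∃ W : Set ((ι → ℝ) × V), IsOpen W ∧ x₀ ∈ W ∧ W ⊆ {x | ∀ i, Real.sin (x.1 i) ≠ 0} ∧
      ∃ C : Set (∀ i, ↥(archLocal L 2 (Matrix.of fun i j : Fin 2 => if i.val + j.val + 1 = 2 then (1 : L) else 0) (wl i))), IsCompact C ∧ ∀ h, h ∉ C → ∀ x ∈ W, H h x = 0 := by
    intro x₀ hx₀
    rw [hH_def]
    exact exists_isCompact_torusIntegrand_eq_zero L wl T hTp hK hg0 x₀ hx₀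
  have hFeq : F = fun x => ∫ h, H h x ∂(Measure.pi ν) := by
    funext x
    rw [show x = (x.1, x.2) from rfl, hF, hH_def, integral_smul]
  intro x hx
  -- order-one jets under the integral sign, then evaluate at `(0, v)`
  have hjet := iteratedFDeriv_integral_eq_of_support_local (μ := Measure.pi ν) hU (fun h => (hHs h).contDiffOn) hHc hHloc 1 hx
  have hint : Integrable (fun h => iteratedFDeriv ℝ 1 (H h) x) (Measure.pi ν) := by
    obtain ⟨ε, hε, gb, hgb, hle⟩ := exists_integrable_forall_norm_iteratedFDeriv_le_of_support_local (μ := Measure.pi ν) hHc hHloc 1 hx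
    exact Integrable.mono' hgb (aestronglyMeasurable_iteratedFDeriv_of_support_local hHc hHloc 1 hx) (Eventually.of_forall fun h => hle h x (Metric.mem_ball_self hε))
  show fderiv ℝ F x ((0 : ι → ℝ), v) = F' x
  have happ : (∫ a, iteratedFDeriv ℝ 1 (H a) x ∂(Measure.pi ν)) (fun _ => ((0 : ι → ℝ), v)) = ∫ a, iteratedFDeriv ℝ 1 (H a) x (fun _ => ((0 : ι → ℝ), v)) ∂(Measure.pi ν) := by
    have h := (ContinuousMultilinearMap.apply ℝ (fun _ : Fin 1 => (ι → ℝ) × V) E (fun _ => ((0 : ι → ℝ), v))).integral_comp_comm hint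
    simpa only [ContinuousMultilinearMap.apply_apply] using h.symm
  rw [hFeq, ← iteratedFDeriv_one_apply (fun _ => ((0 : ι → ℝ), v)), hjet, happ]
  rw [show x = (x.1, x.2) from rfl, hF', ← integral_smul]
  refine integral_congr_ae (Eventually.of_forall fun h => ?_)
  show iteratedFDeriv ℝ 1 (H h) (x.1, x.2) (fun _ => ((0 : ι → ℝ), v)) = _
  rw [iteratedFDeriv_one_apply]
  -- the section rule in the second factor
  have hd : DifferentiableAt ℝ (H h) (x.1, x.2) := (hHs h).differentiable (by simp) _
  have hsec : fderiv ℝ (H h) (x.1, x.2) ((0 : ι → ℝ), v) = fderiv ℝ (fun d => H h (x.1, d)) x.2 v := by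
    have hc : HasFDerivAt (fun d => H h (x.1, d)) ((fderiv ℝ (H h) (x.1, x.2)).comp (ContinuousLinearMap.inr ℝ (ι → ℝ) V)) x.2 :=
      hd.hasFDerivAt.comp x.2 (hasFDerivAt_prodMk_right x.1 x.2)
    rw [hc.fderiv, ContinuousLinearMap.comp_apply, ContinuousLinearMap.inr_apply]
  rw [hsec, hH_def]
  simp only
  have hgd : DifferentiableAt ℝ (fun d => g (d, fun i => (((h i * T i (x.1 i) * (h i)⁻¹ : ↥(archLocal L 2 _ (wl i))) : GL (Fin 2) ℂ) : Matrix (Fin 2) (Fin 2) ℂ))) x.2 :=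
(hg.differentiable (by simp) _).comp x.2 (differentiableAt_id.prodMk (differentiableAt_const _))
  rw [fderiv_fun_const_smul hgd, _root_.smul_apply]

end Functional

end Literature.NumberTheory.Automorphic.UnitaryGroup

end
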